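import Literature.NumberTheory.LFunctions.Zhang2022.RepairRplus
import Literature.NumberTheory.LFunctions.Zhang2022.RepairRplusTightness
import Literature.NumberTheory.LFunctions.Zhang2022.RepairAdmissibleWide
import Literature.NumberTheory.LFunctions.Zhang2022.RepairAdmissibleShiftFree
import Literature.NumberTheory.LFunctions.Zhang2022.RepairRplusSmoothLengths
import Literature.NumberTheory.LFunctions.Zhang2022.RepairRplusJoint
import Literature.NumberTheory.LFunctions.Zhang2022.KnifeEdgeRoughOverhang
import Literature.NumberTheory.LFunctions.Zhang2022.RepairRplusWallZero
import Literature.NumberTheory.LFunctions.Zhang2022.RepairInPrintLengths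

/-!
# Zhang (2022) §18-margin repair rung — THE RUNNING ASSEMBLY `R⁺⁺` of the barrier-extension programme:
# the class of record as ONE list of decided design families, version by version

Trunk T-ANT (NumberTheory/LFunctions). Y. Zhang, *Discrete mean estimates and the Landau–Siegel
zero*, arXiv:2211.02515v1 (2022) [Zhang2022LandauSiegel] — **an unrefereed manuscript under
adjudication. WHAT THIS IS NOT: nothing here asserts or denies its Theorems 1–2 or any analytic lemma;
no claim about Landau–Siegel zeros, about Parity, or about a repaired `Margin232` is made. Every
statement below is about the manuscript's METHOD AS ARCHITECTED — classes of mollifier / profile /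
parameter designs fed to the SAME main-term calculus — not about zeros of `L`-functions.** Cell
`landau-siegel` (rung F-S3), sub-cell E (barrier extension), seat p1, stub S-E-p1-1 «running assembly»
(barrier/ASSIGNMENTS.md, writer ls-barrier-plan): charter LS-PROGRAMME v1.1 §2 row E, «R⁺⁺ ⊇ {every
family §B kills} … done when R⁺⁺ covers every killed family».

## What this file is

`RepairRplus` (p455670) fixed the EXTENSION PROTOCOL: a `Repair.DesignFamily` is one currency of the
record (`Design`, class predicate `InClass` — no analytic hypothesis inside —, verdict shape `Verdict` —
every conditional input of kind (b) «(A)-world hypothesis of record» or (c) «named E*-slot» displayed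
THERE); `F.Decided := ∀ d, F.InClass d → F.Verdict d`; a class is a `List DesignFamily` and
`ClassDecided L := ∀ F ∈ L, F.Decided`; `Rplus = [familyR, familyH1, familyTwoPiece, familyFarPiece]`
with `rplus_decided` (= `Repair.not_repairable_in_Rplus`). Each slice of the sub-cell lands, in ITS OWN
file, a new family together with its ONE `Decided` theorem; THIS file appends the landed families to the
running class and proves the running class decided — nothing already decided is re-proved
(`classDecided_append`, `classDecided_snoc`).

APPEND-ONLY VERSIONING. The file is append-only once landed, so the running class is published as a
sequence of versions `Rplusplus1 ⊆ Rplusplus2 ⊆ …` (list prefixes), each with `rplusplus<k>_decided :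
ClassDecided Rplusplus<k>`, a membership lemma `mem_rplusplus<k>_iff` naming its families, and the
prefix lemma from the previous version; the class OF RECORD is the LAST version in the file (named in
barrier/BARRIER-STATE.md). Version 0 is `Rplus` itself (`rplusplus0_decided`).

## Class table — version 1 (families in list order; K = class predicate, V = verdict currency)

| # | family (decl) | designs, K in words | V (currency) | displayed inputs (kind) | p-id (file) | non-vacuity / tightness |
|---|---|---|---|---|---|---|
| 1 | `familyR` | `θ : Theta`, `AdmissibleTheta θ` = class R: `ν₃ < ν₂ ≤ ½ = cut₁ < ν₁ < 1`, `1 < ν₁+ν₃`, `0 < k₁ = k₃, k₂ < 5`, `ι ∈ ℂ³` free | T-true `¬ (C232S θ·C233T θ < ‖dSumS θ‖²)` | none | p428635 (`RepairVerdictAssembly`), p421602; packaged p455670 | `inRplus_theta0`, `inRplus_thetaIota` |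
| 2 | `familyH1` | pairs of `H¹[0,1]` profiles `(g, f)` = class R̄ (any pieces, tops `≤ 1`, `ℓ = 1`) | profile T-true `¬ (𝔅(g)𝔅(f) < ‖P(g,f)‖²)` | none | p455670 (`not_trueNeed_of_isH1`) | `inRplus_hOne_gStar` |
| 3 | `familyTwoPiece` | smooth two-piece `s·u ⊕ v`, `1 ≤ θ`, `InClassPiece u u′`, `OverhangPiece θ v v′` (declared narrowing: right derivative in `L²(1,θ)`) | X-world POS `¬ (twoPieceMainTerm θ X u u′ v v′ s < 0)` (continued calculus; E-017/E-002 open off R) | `KnifeEdge.InvisibleOverhang θ X` (c), E-002 | p455670 ← p442741 | `inRplus_gStar_phiT`; slot LOAD-BEARING: `not_noMainOrderClosing_without_slot`, `not_invisibleOverhang_zero` (p456612) |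
| 4 | `familyFarPiece` | 1-Lipschitz `‖g‖∞ ≤ 1` profile of any length `P^{1+δ}`, `0 < ε < δ`, shift `c′` | discrete mean: no main-order gain `P^{1+ε} → P^{1+δ}` | `Re ρ = ½` on `Skeleton.idx χ` (b) | p455670 ← p446527 ← p446031 | `inRplus_flatProfile` |
| 5 | `familyRWide` | `θ : Theta`, `AdmissibleThetaWide θ` = R with `ν₂ ≤ ½` and `k₁ = k₃` DELETED (charter word «ν₂ > ½, untied k₃»; walls (R-a)/(R-d) crossed when `ν₂ > ½`) | T-true, continued calculus (validity off R: E-017 open) | none (all five dictionary identities re-proved on the class) | p456882 (`RepairAdmissibleWide`) | `admissibleWide_thetaNuHigh`, `admissibleWide_thetaKUntied` (strict: `not_admissible_…`); embedding `AdmissibleTheta.toWide` |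
| 6 | `familyRCalc` | `θ : Theta`, `AdmissibleThetaCalc θ` = `0 < ν₃ ≤ ν₂ < ν₁ ≤ 1`, `k_j ≠ 0`, `ι`, `cut₁` free — ENGINE CLASS: the widest `Theta` box on which the §18 dictionary is an identity; class BEYOND the charter word; walls for `cut₁ ≠ ½` / `k_j ∉ (0,5)` unnamed | T-true, continued calculus (E-017 open) | none | p456882 | embeddings `AdmissibleThetaWide.toCalc`, `AdmissibleTheta.toCalc` |

KILL-word alignment (REF-E C1): no §B KILL word is countersigned at version 1; families 5–6 pre-cover
the parameter-box sweeps of B-multi/B-len, families 3–4 the smooth pieces past the wall (B-len), family 2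
every multi-piece `H¹` design with tops `≤ 1` (B-multi M0/M4-type). Referee bundle entries: E-1 (p455670,
with addendum «slot inhabited ∧ load-bearing (p456612)»), E-2 (p456882) in barrier/REFEREE-BUNDLE.md.

## References

* Y. Zhang, arXiv:2211.02515v1 (2022), §2 Props. 2.2, 2.4–2.6, (2.32)–(2.33) [p. 4–11], §7 Prop. 7.1,
  (7.2) [p. 44], §12 (12.1)–(12.2), §18 [p. 99–101]. [cite: Zhang2022LandauSiegel, §§2, 7, 12, 18]
-/

noncomputable section

namespace Literature.NumberTheory.LFunctions.Zhang2022

namespace Repair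

/-! ### Bookkeeping: one-step extension of a decided class -/

/-- **snoc**: a decided class extended by ONE decided family is decided (`classDecided_append` +
`classDecided_cons`; the form every version below uses). [cite: Zhang2022LandauSiegel, §2 (2.32)–(2.33)] -/
theorem classDecided_snoc {L : List DesignFamily} {F : DesignFamily} (hL : ClassDecided L)
    (hF : F.Decided) : ClassDecided (L ++ [F]) :=
  classDecided_append.2 ⟨hL, classDecided_cons hF classDecided_nil⟩

/-- A decided class stays decided on every sub-list of families (in particular on every earlier
version). [cite: Zhang2022LandauSiegel, §2 (2.32)–(2.33)] -/
theorem ClassDecided.mono {L L' : List DesignFamily} (h : ClassDecided L') (hsub : ∀ F ∈ L, F ∈ L') :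
    ClassDecided L := fun F hF => h F (hsub F hF)

/-! ### Version 0: `R⁺` itself -/

/-- **Version 0 of the running class is `R⁺`** (`Rplus ++ []`), decided by `rplus_decided`
(= `Repair.not_repairable_in_Rplus`, p455670). [cite: Zhang2022LandauSiegel, §2 (2.32)–(2.33); §7 (7.2) p.44] -/
theorem rplusplus0_decided : ClassDecided (Rplus ++ []) := by
  rw [List.append_nil]; exact rplus_decided

/-! ### Version 1 (2026-08-26): `R⁺ ++ [familyRWide, familyRCalc]` -/

/-- **`R⁺⁺`, version 1**: `R⁺` followed by the «ν₂ > ½, untied k₃» family `familyRWide` and the engine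
class `familyRCalc` (both `RepairAdmissibleWide`, p456882; table rows 5–6 of the module docstring).
[cite: Zhang2022LandauSiegel, §2 (2.21)–(2.26), (2.32)–(2.33); §12 (12.1)–(12.2)] -/
def Rplusplus1 : List DesignFamily := Rplus ++ [familyRWide, familyRCalc]

/-- **Version 1 is decided**: every design of every family of `Rplusplus1` satisfies its family's verdict
— `rplus_decided` (p455670) for rows 1–4, `familyRWide_decided` / `familyRCalc_decided` (p456882) for
rows 5–6; nothing re-proved. [cite: Zhang2022LandauSiegel, §2 Props. 2.4–2.6, (2.32)–(2.33); §7 (7.2) p.44] -/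
theorem rplusplus1_decided : ClassDecided Rplusplus1 :=
  classDecided_append.2
    ⟨rplus_decided, classDecided_cons familyRWide_decided (classDecided_cons familyRCalc_decided classDecided_nil)⟩

/-- The families of version 1, by name (the class is EXACTLY these six).
[cite: Zhang2022LandauSiegel, §2 (2.32)–(2.33)] -/
theorem mem_rplusplus1_iff (F : DesignFamily) :
    F ∈ Rplusplus1 ↔ F = familyR ∨ F = familyH1 ∨ F = familyTwoPiece ∨ F = familyFarPiece ∨
      F = familyRWide ∨ F = familyRCalc := by
  simp only [Rplusplus1, Rplus, List.cons_append, List.nil_append, List.mem_cons, List.not_mem_nil,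
    or_false]

/-- **`R⁺ ⊆ R⁺⁺` (version 1)**: no family of the previous class is dropped (list prefix).
[cite: Zhang2022LandauSiegel, §2 (2.32)–(2.33)] -/
theorem rplus_sub_rplusplus1 : ∀ F ∈ Rplus, F ∈ Rplusplus1 :=
  fun _ hF => List.mem_append.2 (Or.inl hF)

/-- Version 1 restricted to `R⁺` is `rplus_decided` again (consistency of the bookkeeping).
[cite: Zhang2022LandauSiegel, §2 (2.32)–(2.33)] -/
theorem rplusplus1_decided_restrict : ClassDecided Rplus := rplusplus1_decided.mono rplus_sub_rplusplus1

/-- The intermediate class `R⁺ ++ [familyRWide]` of `RepairAdmissibleWide.rplus_wide_decided` is a sub-list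
of version 1 (so that theorem is an instance of `rplusplus1_decided`). [cite: Zhang2022LandauSiegel, §2 (2.32)–(2.33)] -/
theorem rplusplus1_decided_wide : ClassDecided (Rplus ++ [familyRWide]) :=
  rplusplus1_decided.mono fun F hF => by
    rcases List.mem_append.1 hF with h | h
    · exact List.mem_append.2 (Or.inl h)
    · rw [List.mem_singleton] at h
      exact List.mem_append.2 (Or.inr (by simp [h]))

/-- **Unbundled reading of version 1** (what `ClassDecided Rplusplus1` says, family by family, with every
binder literal): the six verdicts of the table. [cite: Zhang2022LandauSiegel, §2 Props. 2.4–2.6, (2.32)–(2.33); §7 (7.2) p.44] -/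
theorem rplusplus1_verdicts :
    (∀ θ, AdmissibleTheta θ → ¬ (C232S θ * C233T θ < ‖dSumS θ‖ ^ 2)) ∧
    (∀ g g' f f' : ℝ → ℂ, IsH1OnUnitInterval g g' → IsH1OnUnitInterval f f' →
        ¬ (mainTermForm g g' * mainTermForm f f' < ‖mainTermFormPolar g g' f f'‖ ^ 2)) ∧
    (∀ (θ : ℝ) (u u' v v' : ℝ → ℂ) (s : ℂ), 1 ≤ θ → KnifeEdge.InClassPiece u u' →
        KnifeEdge.OverhangPiece θ v v' → ∀ X : KnifeEdge.PairFunctional, KnifeEdge.InvisibleOverhang θ X →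
          ¬ (KnifeEdge.twoPieceMainTerm θ X u u' v v' s < 0)) ∧
    (∀ (c' δ ε : ℝ) (g : ℝ → ℂ), 0 < ε → ε < δ → LipschitzWith 1 g → (∀ z, ‖g z‖ ≤ 1) →
        Skeleton.ForAllLarge fun D _ χ =>
          (∀ i ∈ Skeleton.idx χ, (i.2).re = 1 / 2) →
            ¬ (Skeleton.bigP D ^ (-(ε / 8)) *
                  (discMeanAbs c' χ g ⌈Skeleton.bigP D ^ (1 + ε)⌉₊ + discWeight c' χ) <
                |discMean c' χ g ⌈Skeleton.bigP D ^ (1 + δ)⌉₊ -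
                  discMean c' χ g ⌈Skeleton.bigP D ^ (1 + ε)⌉₊|)) ∧
    (∀ θ, AdmissibleThetaWide θ → ¬ (C232S θ * C233T θ < ‖dSumS θ‖ ^ 2)) ∧
    (∀ θ, AdmissibleThetaCalc θ → ¬ (C232S θ * C233T θ < ‖dSumS θ‖ ^ 2)) :=
  ⟨fun θ h => not_repairable_in_Rplus (.inR θ) h,
    fun g g' f f' hg hf => not_repairable_in_Rplus (.hOne g g' f f') ⟨hg, hf⟩,
    fun θ u u' v v' s hθ hu hv => not_repairable_in_Rplus (.twoPiece θ u u' v v' s) ⟨hθ, hu, hv⟩,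
    fun c' δ ε g hε hεδ hg hg1 => not_repairable_in_Rplus (.farPiece c' δ ε g) ⟨hε, hεδ, hg, hg1⟩,
    not_repairable_true_need_wide, not_repairable_true_need_calc⟩

/-! ### Version 2 (2026-08-26): five more decided families

| # | family (decl) | designs, K in words | V (currency) | displayed inputs (kind) | p-id (file) | non-vacuity / tightness / embeddings |
|---|---|---|---|---|---|---|
| 7 | `KnifeEdge.familyRoughTwoPiece` | ROUGH two-piece `s·u ⊕ v`: `1 ≤ θ`, `InClassPiece u u′`, `KnifeEdge.RoughOverhangPiece θ v v′` (`v, v′ ∈ L²(1,θ)`, `= 0` below `1`, piecewise right derivative off a finite set; WALL JUMP `v(1⁺) ≠ 0`, TOP VALUE `v(θ⁻) ≠ 0` and INTERIOR JUMPS allowed — outside `R⁺` by (O1)) | X-world POS `¬ (twoPieceMainTerm θ X u u′ v v′ s < 0)` (continued calculus; validity off R: E-017 / E-002 open) | `KnifeEdge.BandNonnegOn (RoughOverhangPiece θ) θ X` (c; E-005, object `netOverhangBlock` — the (B1) sign is a LEVER, not a theorem) · `KnifeEdge.CrossSubordinateOn (RoughOverhangPiece θ) θ X` (c; E-006, object `crossResidual`)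 | p457552 (`KnifeEdgeRoughOverhang`) ← p442741, p430338 | witness `KnifeEdge.plateau θ` (`roughOverhangPiece_plateau`, a genuine jump at the wall); threshold `KnifeEdge.nullOn_iff`; tightness `KnifeEdge.rough_closesByPositivity_zero` (`X = 0` closes for every `θ > 1`); C2 `KnifeEdge.OverhangPiece.rough` (row 3's class is the smooth sub-class), `KnifeEdge.null_iff_nullOn` |
| 8 | `familyRLengths` | `θ : Theta`, `θ.lengthsInUnit` = `0 < ν₃ ≤ ν₂ < ν₁ ≤ 1`; EVERY `k ∈ ℝ³` (untwisted `k = 0` included), `ι`, `cut₁` free — k-FREE ENGINE BOX: supersedes `familyRCalc` (row 6, kept — append-only, redundant and harmless) as the widest `Theta` box on which the §18 dictionary is an identity; class beyond the charter word; walls: none beyond E-017 (+ LEVERS L16 for `k = 0`) | T-true, continued calculus (E-017 open off R) | none | p457555 (`RepairAdmissibleShiftFree`) | strict witness `thetaUntwisted` (`k₃ = 0`, `not_admissibleCalc_thetaUntwisted`); embeddings `AdmissibleThetaCalc.lengthsInUnit`, `AdmissibleThetaWide.lengthsInUnit`, `familyRCalc_inClass_lengths`; `rplus_wide_lengths_decided`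 |
| 9 | `familySmoothLengths` | `SmoothDesign (c′, K, M, g)`: profile `g` `K`-Lipschitz on `[1,∞)` with `‖g‖ ≤ M` there — regularity on the OVERHANG REGION ONLY (declared WIDENING of the class text «1-Lipschitz, ‖·‖∞ ≤ 1»; arbitrary below the wall) | discrete mean: for every `0 < ε < δ` and ANY two lengths `⌈P^{1+ε}⌉ ≤ N₁ ≤ N₂ ≤ ⌈P^{1+δ}⌉`, no main-order gain, bound `P^{−ε/8}(discMeanAbs(N₁) + max(K,M)²·discWeight)` | `Re ρ = ½` on `Skeleton.idx χ` (b) | p457377 (`RepairRplusSmoothLengths`) ← p456962, p456650, p455698 ← p446527, p446031 | C2: row 4 embeds (`SmoothDesign.ofFarPiece`, `inClass_ofFarPiece`, `familyFarPiece_decided_of_smooth`: `familyFarPiece` = the case `K = M = 1`, the two ceiling lengths) |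
| 10 | `familySmoothTop` | `SmoothTopDesign` = row 9 + a declared length `θ` with `g = 0` on `[θ,∞)` (smooth TOP-VANISHING piece of ANY length) | discrete mean: the FULL polynomial (any `N ≥ ⌈P^{1+ε}⌉`, no upper cut) gains nothing at main order over the cut at `⌈P^{1+ε}⌉`, every `ε > 0` | `Re ρ = ½` (b) | p457377 | — |
| 11 | `familyTwoPieceJoint` | `JointDesign` = smooth two-piece `s·u ⊕ v` (`1 ≤ θ`, `InClassPiece u u′`, `OverhangPiece θ v v′` — declared narrowing as in row 3) + an in-class PROBE `f` (`InClassPiece f f′`) | JOINT T-true `¬ (twoPieceMainTerm θ X u u′ v v′ s · 𝔅(f) < ‖twoPieceCross θ X u u′ v v′ s f f′‖²)` (continued calculus; E-017 / E-002 open) | `KnifeEdge.InvisibleOverhang θ X` (c; E-002) — the SAME slot as row 3, applied also to the probe | p457753 (`RepairRplusJoint`) ← p442741 | `familyTwoPieceJoint_inClass_star` (`g⋆ ⊕ φ_θ` vs probe `g⋆`); slot inhabited `exists_invisibleOverhang`; slot load-bearing `jointCloses_zero` / `familyTwoPieceJoint_slot_loadBearing`; link `familyTwoPieceJoint_toTwoPiece`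 |

KILL-word alignment (REF-E C1): still no countersigned §B KILL word at version 2 (T_B0+16h ≈ 2026-08-27T08:10Z);
row 7 is the first `R⁺⁺ \ R⁺` family on the B-multi / B-len side (jump at the wall), rows 8, 5–6 the parameter
boxes, rows 9–10 the smooth long pieces in the discrete-mean currency (B-len), row 11 the two-piece class in the
§2 joint currency. -/

/-- **`R⁺⁺`, version 2**: version 1 followed by the rough two-piece family (`KnifeEdge.familyRoughTwoPiece`,
p457552), the k-free lengths box (`familyRLengths`, p457555), the smooth-lengths and smooth-top-vanishing
families in the discrete-mean currency (`familySmoothLengths`, `familySmoothTop`, p457377) and the two-piece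
family in the joint currency (`familyTwoPieceJoint`, p457753) — rows 7–11 of the version-2 table above.
[cite: Zhang2022LandauSiegel, §2 (2.16)–(2.20), (2.21)–(2.28), (2.32)–(2.33); §7 (7.2) p.44] -/
def Rplusplus2 : List DesignFamily :=
  Rplusplus1 ++ [KnifeEdge.familyRoughTwoPiece, familyRLengths, familySmoothLengths, familySmoothTop,
    familyTwoPieceJoint]

/-- **Version 2 is decided**: `rplusplus1_decided` for rows 1–6 and the five landed `…_decided` theorems for
rows 7–11 (`KnifeEdge.familyRoughTwoPiece_decided`, `familyRLengths_decided`, `familySmoothLengths_decided`,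
`familySmoothTop_decided`, `familyTwoPieceJoint_decided`); nothing re-proved.
[cite: Zhang2022LandauSiegel, §2 Props. 2.4–2.6, (2.16)–(2.20), (2.32)–(2.33); §7 (7.2) p.44] -/
theorem rplusplus2_decided : ClassDecided Rplusplus2 :=
  classDecided_append.2
    ⟨rplusplus1_decided,
      classDecided_cons KnifeEdge.familyRoughTwoPiece_decided <| classDecided_cons familyRLengths_decided <|
        classDecided_cons familySmoothLengths_decided <| classDecided_cons familySmoothTop_decided <|
          classDecided_cons familyTwoPieceJoint_decided classDecided_nil⟩

/-- The families of version 2, by name (the class is EXACTLY these eleven).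
[cite: Zhang2022LandauSiegel, §2 (2.32)–(2.33)] -/
theorem mem_rplusplus2_iff (F : DesignFamily) :
    F ∈ Rplusplus2 ↔ F = familyR ∨ F = familyH1 ∨ F = familyTwoPiece ∨ F = familyFarPiece ∨
      F = familyRWide ∨ F = familyRCalc ∨ F = KnifeEdge.familyRoughTwoPiece ∨ F = familyRLengths ∨
      F = familySmoothLengths ∨ F = familySmoothTop ∨ F = familyTwoPieceJoint := by
  simp only [Rplusplus2, Rplusplus1, Rplus, List.cons_append, List.nil_append, List.mem_cons,
    List.not_mem_nil, or_false]

/-- **Version 1 ⊆ version 2** (list prefix: no family dropped). [cite: Zhang2022LandauSiegel, §2 (2.32)–(2.33)] -/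
theorem rplusplus1_sub_rplusplus2 : ∀ F ∈ Rplusplus1, F ∈ Rplusplus2 :=
  fun _ hF => List.mem_append.2 (Or.inl hF)

/-- `R⁺ ⊆` version 2. [cite: Zhang2022LandauSiegel, §2 (2.32)–(2.33)] -/
theorem rplus_sub_rplusplus2 : ∀ F ∈ Rplus, F ∈ Rplusplus2 :=
  fun F hF => rplusplus1_sub_rplusplus2 F (rplus_sub_rplusplus1 F hF)

/-- Version 2 restricted to version 1 (consistency of the bookkeeping). [cite: Zhang2022LandauSiegel, §2 (2.32)–(2.33)] -/
theorem rplusplus2_decided_restrict : ClassDecided Rplusplus1 := rplusplus2_decided.mono rplusplus1_sub_rplusplus2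

/-- The slice files' partial assemblies are instances of version 2: `R⁺ ++ [rough two-piece]`
(`KnifeEdge.rplus_rough_decided`), `R⁺ ++ [familyRWide, familyRLengths]` (`rplus_wide_lengths_decided`) and
`R⁺ ++ [familyTwoPieceJoint]` (`rplus_joint_decided`) are sub-lists. [cite: Zhang2022LandauSiegel, §2 (2.32)–(2.33)] -/
theorem rplusplus2_decided_sublists :
    ClassDecided (Rplus ++ [KnifeEdge.familyRoughTwoPiece]) ∧
      ClassDecided (Rplus ++ [familyRWide, familyRLengths]) ∧
        ClassDecided (Rplus ++ [familyTwoPieceJoint]) := by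
  refine ⟨rplusplus2_decided.mono fun F hF => ?_, rplusplus2_decided.mono fun F hF => ?_,
    rplusplus2_decided.mono fun F hF => ?_⟩ <;>
  · simp only [Rplus, List.cons_append, List.nil_append, List.mem_cons, List.not_mem_nil, or_false,
      mem_rplusplus2_iff] at hF ⊢
    tauto

/-- **Unbundled reading of rows 7–11** (what version 2 adds, every binder literal or the slice's own
predicate): the rough two-piece verdict with its two displayed slots; the lengths-only box; the two smooth
discrete-mean verdicts; the joint two-piece verdict with the displayed invisibility slot.
[cite: Zhang2022LandauSiegel, §2 Props. 2.4–2.6, (2.16)–(2.20), (2.32)–(2.33); §7 (7.2) p.44] -/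
theorem rplusplus2_verdicts :
    (∀ (θ : ℝ) (u u' v v' : ℝ → ℂ) (s : ℂ), 1 ≤ θ → KnifeEdge.InClassPiece u u' →
        KnifeEdge.RoughOverhangPiece θ v v' → ∀ X : KnifeEdge.PairFunctional,
          KnifeEdge.BandNonnegOn (KnifeEdge.RoughOverhangPiece θ) θ X →
            KnifeEdge.CrossSubordinateOn (KnifeEdge.RoughOverhangPiece θ) θ X →
              ¬ (KnifeEdge.twoPieceMainTerm θ X u u' v v' s < 0)) ∧
    (∀ θ : Theta, θ.lengthsInUnit → ¬ (C232S θ * C233T θ < ‖dSumS θ‖ ^ 2)) ∧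
    (∀ d : SmoothDesign, d.InClass → d.Verdict) ∧
    (∀ d : SmoothTopDesign, d.InClass → d.Verdict) ∧
    (∀ (θ : ℝ) (u u' v v' : ℝ → ℂ) (s : ℂ) (f f' : ℝ → ℂ), 1 ≤ θ → KnifeEdge.InClassPiece u u' →
        KnifeEdge.OverhangPiece θ v v' → KnifeEdge.InClassPiece f f' →
          ∀ X : KnifeEdge.PairFunctional, KnifeEdge.InvisibleOverhang θ X →
            ¬ (KnifeEdge.twoPieceMainTerm θ X u u' v v' s * mainTermForm f f'
                < ‖twoPieceCross θ X u u' v v' s f f'‖ ^ 2)) :=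
  ⟨fun _ _ _ _ _ s hθ hu hv X hB hC => KnifeEdge.not_repairable_rough_twoPiece hθ hu hv s X hB hC,
    not_repairable_true_need_of_lengths,
    fun d h => SmoothDesign.verdict_of_inClass d h,
    fun d h => SmoothTopDesign.verdict_of_inClass d h,
    fun θ u u' v v' s f f' hθ hu hv hf X hX =>
      familyTwoPieceJoint_decided ⟨θ, u, u', v, v', s, f, f'⟩ ⟨hθ, hu, hv, hf⟩ X hX⟩

/-! ### Version 3 (2026-08-26): three more decided families, and two C1 notes on earlier rows

| # | family (decl) | designs, K in words | V (currency) | displayed inputs (kind) | p-id (file) | non-vacuity / tightness / embeddings |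
|---|---|---|---|---|---|---|
| 12 | `familyWallZero` | `WallZeroDesign (c′, g)`: the FULL profile `g` globally 1-Lipschitz, `‖g‖∞ ≤ 1`, wall value `g(1) = 0` (any length; the charter's regularity verbatim + the wall-zero clause) | discrete mean FROM THE WALL: for every `0 < w < δ` and every `C`, no main-order gain over the bulk below `P` at ANY length `⌈P^{1+w}⌉ ≤ N ≤ ⌈P^{1+δ}⌉` (bound `C·w·(discMeanAbs⌈P⌉ + discWeight) + P^{−w/8}(discMeanAbs⌈P^{1+w}⌉ + discWeight)`) | `Repair.DiscMeanBandWidthWall0 c′ w C` (c; E-004 of record, p458872 — the band-width slot IS the join of the two `R⁺ \ R̄` currencies that bundle E-1 N1 says no theorem provides) · `Re ρ = ½` on `Skeleton.idx χ` (b) | p459259 (`RepairRplusWallZero`) ← p457769, p458872, p457377 | C2 `WallZeroDesign.inClass_toSmooth` (→ row 9's class); C4 `inClass_triangle` (triangle profile, `1 ≤ θ ≤ 3`); slot tightness NOT in tree (needs the (A)-world band main term; E-005: the unrestricted slot fails for `g(1) ≠ 0` — hence the wall-zero class) |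
| 13 | `familyWallZeroTop` | `WallZeroTopDesign` = row 12 + declared length `θ` with `g = 0` on `[θ,∞)` | discrete mean: the FULL polynomial (every `N ≥ ⌈P^{1+w}⌉`) gains nothing at main order over the bulk below `P`, every `w > 0`, `C` | same two | p459259 | C4 `inClassTop_triangle` |
| 14 | `familyInPrintLen` | `θ : Theta`, `AdmissibleThetaLen θ` = class R with `belowP` (`ν₁ < 1`) DELETED, every other conjunct verbatim (so lengths `≥ P` lie in the class) | T-true `¬ (C232S θ·C233T θ < ‖dSumS θ‖²)` UNDER the slot (continued-calculus constants; never evaluated at `ν₁ ≥ 1` since the slot forces `ν₁ < 1`; validity off R: E-017 / E-001 / E-002 open) | `Repair.InPrintOffDiagonalRange θ` (c): every modulus exponent of the design's off-diagonal sum is controlled by an input IN PRINT — small moduli (Lemma 5.6), the multiplicative large sieve (7.15), `DukeFriedlanderIwaniec1997_bilinearKloostermanFractions`, `BettinChandee2018_trilinearKloostermanFractions` (in-tree facts by name; NOT `Eq148DUniform` = E-016); the slot DERIVES `ν₁ < 1` (`belowP_of_inPrintOffDiagonalRange`) and conversely `inPrintOffDiagonalRange_iff_belowP` (printed range = the wall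 exactly); modelling caveat (p4's docstring): the exponent model is reconstructed desk bookkeeping | p459189 (`RepairInPrintLengths`) ← p428635, p457555 | C2 `AdmissibleTheta.toLen`, `familyR_inClass_toLen` (slot holds on R: `inPrintOffDiagonalRange_of_admissible`); C4 + slot LOAD-BEARING: `thetaLen ν` with `ν ≥ 1` is in the class and the slot FAILS there (`admissibleThetaLen_thetaLen`, `not_inPrintOffDiagonalRange_thetaLen`) |

C1 NOTES on earlier rows (requested by the referee / planner; append-only, so recorded here):
* Row 2 `familyH1` — INTAKE GUARD G1 (ls-barrier-plan COVERAGE.md v1.2): the class predicate is bare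
  `IsH1OnUnitInterval` and the verdict `¬ (𝔅(g)𝔅(f) < ‖P(g,f)‖²)` is a true statement about the forms, but `𝔅` IS the
  (A)-world main term only via the formula-I/(4.1) dictionary with `g(1) = 0` (`Det.FormDet_zhang`, hypothesis `hg1`;
  off `g(1) = 0`, `2Re Mform ≠ 𝔅`). Hence a §B word whose bulk profiles carry a nonzero LEFT wall value (sharp cut at
  `P`, `g(1⁻) ≠ 0` — OBJECTIVE §1.3 (O1)) is never intaken as «decided by `familyH1` / R̄»: it goes to
  `familyWallBand` (model currency; S-E-p3-3) or «pending», and any intake corollary citing a 𝔅-currency family states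
  `g(1) = 0`.
* Row 7 `KnifeEdge.familyRoughTwoPiece` — DECLARED EXCLUSIONS (p457552 module docstring, verbatim): «Deliberately NOT
  here: the glue identity `Re 𝔅_θ(s·u + v) = q_0(s)` (sesquilinear expansion of `M_θ` on the rough class); in-class
  pieces with a nonzero LEFT value at the wall (`u(1⁻) ≠ 0`, a sharp cut-off at `n = P` — the «E-multi-jump» locus of
  the cell's OBJECTIVE §1.3, sign `+`); several in-class pieces with independent scalars (the `(m+1)×(m+1)` completed
  Gram matrix); any instantiation of `X` (the typers' band functional / wall data, rows E-005/E-006 — to be plugged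
  into `BandNonnegOn`/`CrossSubordinateOn` when typed).» Slots inhabited ∧ load-bearing: `KnifeEdge.exists_slots_rough`,
  `KnifeEdge.not_crossSubordinateOn_rough_zero` (`rplusplus3_slotEvidence` below).
* Row 8 `familyRLengths` ⊇ row 6 `familyRCalc` by `familyRCalc_inClass_lengths` (same engine-class flag).

KILL-word alignment: no countersigned §B word yet. -/

/-- **`R⁺⁺`, version 3**: version 2 followed by the two from-the-wall families in the discrete-mean currency with the
typed band-width slot E-004 (`familyWallZero`, `familyWallZeroTop`, p459259) and the in-print-lengths family with the
displayed in-print off-diagonal slot (`familyInPrintLen`, p459189) — rows 12–14 of the version-3 table above.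
[cite: Zhang2022LandauSiegel, §2 (2.16)–(2.20), (2.32)–(2.33); §7 (7.2), (7.11)–(7.15)] -/
def Rplusplus3 : List DesignFamily :=
  Rplusplus2 ++ [familyWallZero, familyWallZeroTop, familyInPrintLen]

/-- **Version 3 is decided**: `rplusplus2_decided` for rows 1–11 and `familyWallZero_decided`,
`familyWallZeroTop_decided` (p459259), `familyInPrintLen_decided` (p459189) for rows 12–14; nothing re-proved.
[cite: Zhang2022LandauSiegel, §2 Props. 2.4–2.6, (2.16)–(2.20), (2.32)–(2.33); §7 (7.2) p.44] -/
theorem rplusplus3_decided : ClassDecided Rplusplus3 :=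
  classDecided_append.2
    ⟨rplusplus2_decided,
      classDecided_cons familyWallZero_decided <| classDecided_cons familyWallZeroTop_decided <|
        classDecided_cons familyInPrintLen_decided classDecided_nil⟩

/-- The families of version 3, by name (the class is EXACTLY these fourteen).
[cite: Zhang2022LandauSiegel, §2 (2.32)–(2.33)] -/
theorem mem_rplusplus3_iff (F : DesignFamily) :
    F ∈ Rplusplus3 ↔ F = familyR ∨ F = familyH1 ∨ F = familyTwoPiece ∨ F = familyFarPiece ∨
      F = familyRWide ∨ F = familyRCalc ∨ F = KnifeEdge.familyRoughTwoPiece ∨ F = familyRLengths ∨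
      F = familySmoothLengths ∨ F = familySmoothTop ∨ F = familyTwoPieceJoint ∨ F = familyWallZero ∨
      F = familyWallZeroTop ∨ F = familyInPrintLen := by
  simp only [Rplusplus3, Rplusplus2, Rplusplus1, Rplus, List.cons_append, List.nil_append, List.mem_cons,
    List.not_mem_nil, or_false]

/-- **Version 2 ⊆ version 3** (list prefix: no family dropped). [cite: Zhang2022LandauSiegel, §2 (2.32)–(2.33)] -/
theorem rplusplus2_sub_rplusplus3 : ∀ F ∈ Rplusplus2, F ∈ Rplusplus3 :=
  fun _ hF => List.mem_append.2 (Or.inl hF)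

/-- `R⁺ ⊆` version 3. [cite: Zhang2022LandauSiegel, §2 (2.32)–(2.33)] -/
theorem rplus_sub_rplusplus3 : ∀ F ∈ Rplus, F ∈ Rplusplus3 :=
  fun F hF => rplusplus2_sub_rplusplus3 F (rplus_sub_rplusplus2 F hF)

/-- Version 3 restricted to version 2 (consistency of the bookkeeping). [cite: Zhang2022LandauSiegel, §2 (2.32)–(2.33)] -/
theorem rplusplus3_decided_restrict : ClassDecided Rplusplus2 := rplusplus3_decided.mono rplusplus2_sub_rplusplus3

/-- The slice files' partial assemblies are instances of version 3: `R⁺ ++ [familyWallZero, familyWallZeroTop]`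
(`rplus_wallZero_decided`) and `R⁺ ++ [familyInPrintLen]` (`rplus_inPrintLen_decided`) are sub-lists.
[cite: Zhang2022LandauSiegel, §2 (2.32)–(2.33)] -/
theorem rplusplus3_decided_sublists :
    ClassDecided (Rplus ++ [familyWallZero, familyWallZeroTop]) ∧ ClassDecided (Rplus ++ [familyInPrintLen]) := by
  refine ⟨rplusplus3_decided.mono fun F hF => ?_, rplusplus3_decided.mono fun F hF => ?_⟩ <;>
  · simp only [Rplus, List.cons_append, List.nil_append, List.mem_cons, List.not_mem_nil, or_false,
      mem_rplusplus3_iff] at hF ⊢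
    tauto

/-- **Unbundled reading of rows 12–14** (what version 3 adds, through each slice's own predicate / with literal
binders): the two from-the-wall discrete-mean verdicts with the band-width slot displayed, and the in-print-lengths
verdict with its slot displayed. [cite: Zhang2022LandauSiegel, §2 (2.16)–(2.20), (2.32)–(2.33); §7 (7.2), (7.15)] -/
theorem rplusplus3_verdicts :
    (∀ d : WallZeroDesign, d.InClass → d.Verdict) ∧
    (∀ d : WallZeroTopDesign, d.InClass → d.Verdict) ∧
    (∀ θ : Theta, AdmissibleThetaLen θ → InPrintOffDiagonalRange θ →
        ¬ (C232S θ * C233T θ < ‖dSumS θ‖ ^ 2)) :=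
  ⟨fun d h => WallZeroDesign.verdict_of_inClass d h, fun d h => WallZeroTopDesign.verdict_of_inClass d h,
    fun θ h hs => familyInPrintLen_decided θ h hs⟩

/-- **Slot evidence of the class of record (version 3), packaged**: every displayed E*-slot of kind (c) whose
tightness is in tree is INHABITED and LOAD-BEARING — row 3/11 (`InvisibleOverhang`: some invisible world exists for
every `θ`; the continued calculus `X = 0` is not invisible and closes in both the POS and the joint currency for
`θ > 1`), row 7 (the two rough slots are jointly satisfiable for every `θ`; cross-subordination fails at `X = 0`,
which closes on the rough class), row 14 (the in-print slot holds on all of R and fails at a class member of length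
`≥ P`). Rows 12–13's band slot E-004 has no tightness theorem in tree (recorded in the table).
[cite: Zhang2022LandauSiegel, §7 (7.2) p.44; §2 (2.32)–(2.33)] -/
theorem rplusplus3_slotEvidence {θ : ℝ} (hθ : 1 < θ) :
    ((∃ X : KnifeEdge.PairFunctional, KnifeEdge.InvisibleOverhang θ X) ∧ ¬ KnifeEdge.InvisibleOverhang θ 0 ∧
        KnifeEdge.ClosesByPositivity θ 0 ∧
        (∀ s : ℂ, KnifeEdge.twoPieceMainTerm θ 0 gStar gStar' (phiT θ) (phiT' θ) s * mainTermForm gStar gStar'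
          < ‖twoPieceCross θ 0 gStar gStar' (phiT θ) (phiT' θ) s gStar gStar'‖ ^ 2)) ∧
    ((∃ X : KnifeEdge.PairFunctional, KnifeEdge.BandNonnegOn (KnifeEdge.RoughOverhangPiece θ) θ X ∧
          KnifeEdge.CrossSubordinateOn (KnifeEdge.RoughOverhangPiece θ) θ X) ∧
        ¬ KnifeEdge.CrossSubordinateOn (KnifeEdge.RoughOverhangPiece θ) θ 0 ∧
        KnifeEdge.ClosesByPositivityOn (KnifeEdge.RoughOverhangPiece θ) θ 0) ∧
    ((∀ ϑ : Theta, AdmissibleTheta ϑ → InPrintOffDiagonalRange ϑ) ∧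
        (∀ ν : ℝ, 1 ≤ ν → AdmissibleThetaLen (thetaLen ν) ∧ ¬ InPrintOffDiagonalRange (thetaLen ν))) :=
  ⟨⟨exists_invisibleOverhang θ, not_invisibleOverhang_zero hθ, closesByPositivity_zero hθ,
      fun s => jointCloses_zero hθ s⟩,
    ⟨KnifeEdge.exists_slots_rough θ, KnifeEdge.not_crossSubordinateOn_rough_zero hθ,
      KnifeEdge.rough_closesByPositivity_zero hθ⟩,
    ⟨fun _ h => inPrintOffDiagonalRange_of_admissible h,
      fun ν hν => ⟨admissibleThetaLen_thetaLen (by linarith), not_inPrintOffDiagonalRange_thetaLen hν⟩⟩⟩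

end Repair

end Literature.NumberTheory.LFunctions.Zhang2022
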